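import Literature.NumberTheory.Automorphic.GLnCuspidalSiegelKernel
import Literature.NumberTheory.Automorphic.SmoothedCuspForms
import Literature.NumberTheory.Automorphic.AdelicGroupDataGLnProofs
import HarnessLib

/-!
# Iterated differences of a smoothed `L²`-form along a block unipotent radical at a cusp point
(Garrett, *Modern Analysis of Automorphic Forms by Example* (2018), §7.3, proof of Thm. 7.3.10,
PDF pp. 336–342)

The analytic identity at the heart of the basic estimate for cusp forms on a Siegel set
(`GLnCuspidalSpectrum.norm_smoothedForm_le_of_isSiegelSetGL`, Garrett Thm. 7.3.10), on the tree's
honest objects. For `f ∈ L²(GL_n(𝔸_K) ⧸ A_G GL_n(K), μ)` (any `L²`-class — cuspidality is not used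
in this file), a test function `η`, `θ ∈ GL_n(𝔸_K)` and `a = posRealDiagonal b`, the smoothed form
`R(η) f` read along the block unipotents at the point `[θ a⁻¹]`,
`h(Y) = R(η) f ([θ a⁻¹ (1 + Y)])`, `Y ∈ 𝔫_k(𝔸_K)`, is the orbital integral of the kernel slice
`E_g(Y) = η(θ · a⁻¹(1+Y)a · g)` (`siegelKernelSlice`) against `g ↦ f(g⁻¹ a⁻¹ x₀)`
(`smoothedForm_translate_unipotent_eq_integral`: `θ a⁻¹ (1+Y) = (θ · a⁻¹(1+Y)a) a⁻¹`, left
invariance of the Haar measure, `orbitalSmoothing_smul`). Hence its iterated differences are the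
orbital integrals of those of `E_g` (`iterFwdDiff_integral`), which by `GLnCuspidalSiegelKernel`
vanish off a fixed compact `C♯ = W⁻¹ Θ⁻¹ supp η` and are bounded by `B σ^q` on it:

* `norm_iterFwdDiff_smoothedForm_unipotent_le` —
  **`‖Δ_{X₁} ⋯ Δ_{X_q} h (0)‖ ≤ B σ^q ∫_{C♯} ‖f(g⁻¹ a⁻¹ x₀)‖ dg`** for steps `Xᵢ` in the scaled Tate
  domain `c · 𝓕₀`, given the level invariance `hcinv` over `Θ ∋ θ`, a compact `W` containing the
  conjugates of the partial sums of the steps, the derivative bound `B` for the archimedean slices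
  through `Θ · C♯`, and the step bound `σ`.

This is Garrett's "part of the kernel that interacts with cuspforms has an estimate …
`|(φ · f)(y)| ≪ … ∫ |f(x)| dx`" (PDF p. 342), with the Poisson-summation estimate of the kernel
replaced by the smooth bound on iterated differences. Everything here is proved.

Typing convention: group elements and subsets of `GL_n(𝔸_K)` are typed `GL (Fin n) (AdeleRing (𝓞 K) K)`
as in `GLnCuspidalSiegelKernel`; the two elements that act on the automorphic quotient or enter the
Haar integral (`a = posRealDiagonal b` and the cusp point `x = θ a⁻¹`) are variables of the datum's
type `(AdelicGroupData.gl n K).Adelic` (which *is* `GL_n(𝔸_K)`, `AdelicGroupData.gl`) pinned by the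
equations `ha`, `hx`.

## References

* P. Garrett, *Modern Analysis of Automorphic Forms by Example* (2018), §7.3, proof of
  Thm. 7.3.10, PDF pp. 336–342 [Garrett2018].
-/

noncomputable section

open scoped MatrixGroups NNReal Classical Pointwise ContDiff ENNReal
open NumberField NumberField.mixedEmbedding IsDedekindDomain Set Filter MeasureTheory Measure
open Literature.Analysis.Calculus
open _root_.Topology

namespace Literature.NumberTheory.Automorphic

variable {n k : ℕ} {K : Type} [Field K] [NumberField K]

/-! ### Algebraic preliminaries -/

/-- Block unipotents `1 + Y`, `Y ∈ 𝔫_k`, are upper unitriangular (`i < k ≤ j` forces `i < j`).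
[folklore] -/
theorem unipotentOfBlock_mem_upperUnitriangular {R : Type*} [CommRing R] (Y : blockNilpotent n k R) :
    unipotentOfBlock n k R (Multiplicative.ofAdd Y) ∈ upperUnitriangular (Fin n) R := by
  rw [mem_upperUnitriangular_iff, coe_unipotentOfBlock]
  refine ⟨fun i j hji => ?_, fun i => ?_⟩
  · have hji' : j < i := hji
    have hY : (Y : Matrix (Fin n) (Fin n) R) i j = 0 :=
      apply_eq_zero_of_mem_blockNilpotent Y.2 fun h => by
        have h1 : (i : ℕ) < (j : ℕ) := lt_of_lt_of_le h.1 h.2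
        exact absurd h1 (not_lt.2 (Fin.le_def.1 hji'.le))
    change (1 : Matrix (Fin n) (Fin n) R) i j + (Y : Matrix (Fin n) (Fin n) R) i j = 0
    rw [hY, add_zero, Matrix.one_apply_ne (ne_of_gt hji')]
  · have hY : (Y : Matrix (Fin n) (Fin n) R) i i = 0 :=
      apply_eq_zero_of_mem_blockNilpotent Y.2 fun h => absurd (lt_of_lt_of_le h.1 h.2) (lt_irrefl _)
    change (1 : Matrix (Fin n) (Fin n) R) i i + (Y : Matrix (Fin n) (Fin n) R) i i = 1
    rw [hY, add_zero, Matrix.one_apply_eq]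

/-- `X ↦ 1 + X : 𝔫_k(𝔸_K) → GL_n(𝔸_K)` is continuous (`continuous_glUnipotent_ofAdd`, restated on the
carrier `GL (Fin n) (AdeleRing (𝓞 K) K)`). [folklore] -/
theorem continuous_unipotentOfBlockOfAdd :
    Continuous fun X : blockNilpotent n k (AdeleRing (𝓞 K) K) =>
      unipotentOfBlock n k (AdeleRing (𝓞 K) K) (Multiplicative.ofAdd X) := by
  refine Units.continuous_iff.2 ⟨?_, ?_⟩
  · exact continuous_const.add continuous_subtype_val
  · exact continuous_const.sub continuous_subtype_val

/-- Iterated differences commute with the real-to-complex coercion and a constant factor.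
[folklore] -/
theorem iterFwdDiff_ofReal_mul_const {V : Type*} [AddCommGroup V] (φ : V → ℝ) (c : ℂ) (l : List V)
    (x : V) : iterFwdDiff l (fun Y => ((φ Y : ℝ) : ℂ) * c) x = ((iterFwdDiff l φ x : ℝ) : ℂ) * c := by
  induction l generalizing x with
  | nil => rfl
  | cons w l ih =>
    rw [iterFwdDiff_cons, iterFwdDiff_cons, fwdDiff_apply', fwdDiff_apply', ih, ih, Complex.ofReal_sub,
      sub_mul]

/-- `a⁻¹ (1 + Y) = (1 + blockConj b Y) a⁻¹` for `a = posRealDiagonal b`, in `GL_n(𝔸_K)`. [folklore] -/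
theorem posRealDiagonal_inv_mul_unipotentOfBlock (b : Fin n → ℝ≥0ˣ)
    (Y : blockNilpotent n k (AdeleRing (𝓞 K) K)) :
    (posRealDiagonal n K b)⁻¹ * unipotentOfBlock n k (AdeleRing (𝓞 K) K) (Multiplicative.ofAdd Y) =
      unipotentOfBlock n k (AdeleRing (𝓞 K) K) (Multiplicative.ofAdd (blockConj b Y)) *
        (posRealDiagonal n K b)⁻¹ := by
  rw [← posRealDiagonal_inv_mul_unipotentOfBlock_mul b Y, mul_inv_cancel_right]

/-- `θ a⁻¹ (1 + Y) = (θ (1 + blockConj b Y)) a⁻¹` for `a = posRealDiagonal b`. [folklore] -/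
theorem mul_posRealDiagonal_inv_mul_unipotentOfBlock (θ : GL (Fin n) (AdeleRing (𝓞 K) K))
    (b : Fin n → ℝ≥0ˣ) (Y : blockNilpotent n k (AdeleRing (𝓞 K) K)) :
    θ * (posRealDiagonal n K b)⁻¹ * unipotentOfBlock n k (AdeleRing (𝓞 K) K) (Multiplicative.ofAdd Y) =
      θ * unipotentOfBlock n k (AdeleRing (𝓞 K) K) (Multiplicative.ofAdd (blockConj b Y)) *
        (posRealDiagonal n K b)⁻¹ := by
  rw [mul_assoc, posRealDiagonal_inv_mul_unipotentOfBlock, ← mul_assoc]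

/-! ### The smoothed form along the block unipotents as an orbital integral of the kernel slice -/

section Orbital

variable {μ : Measure (AdelicGroupData.gl n K).automorphicQuotient}
  [(AdelicGroupData.gl n K).IsAutomorphicMeasure μ]

attribute [local instance] adelicBorel borelSpace_adelic locallyCompactSpace_adelic
  secondCountableTopology_gl_adelic

/-- The kernel slice is continuous in the group variable. [folklore] -/
theorem continuous_siegelKernelSlice_left {η : GL (Fin n) (AdeleRing (𝓞 K) K) → ℝ} (hη : Continuous η)
    (θ : GL (Fin n) (AdeleRing (𝓞 K) K)) (b : Fin n → ℝ≥0ˣ)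
    (Y : blockNilpotent n k (AdeleRing (𝓞 K) K)) :
    Continuous fun g : (AdelicGroupData.gl n K).Adelic => ((siegelKernelSlice η θ g b Y : ℝ) : ℂ) :=
  Complex.continuous_ofReal.comp (hη.comp ((continuous_const (y :=
    θ * unipotentOfBlock n k (AdeleRing (𝓞 K) K) (Multiplicative.ofAdd (blockConj b Y)))).mul
      continuous_id))

/-- The kernel slice has compact support in the group variable. [folklore] -/
theorem hasCompactSupport_siegelKernelSlice_left {η : GL (Fin n) (AdeleRing (𝓞 K) K) → ℝ}
    (hηs : HasCompactSupport η) (θ : GL (Fin n) (AdeleRing (𝓞 K) K)) (b : Fin n → ℝ≥0ˣ)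
    (Y : blockNilpotent n k (AdeleRing (𝓞 K) K)) :
    HasCompactSupport fun g : (AdelicGroupData.gl n K).Adelic =>
      ((siegelKernelSlice η θ g b Y : ℝ) : ℂ) := by
  have h := (hηs.comp_homeomorph (Homeomorph.mulLeft
    (θ * unipotentOfBlock n k (AdeleRing (𝓞 K) K) (Multiplicative.ofAdd (blockConj b Y))))).comp_left
    Complex.ofReal_zero
  have h' : HasCompactSupport fun g : GL (Fin n) (AdeleRing (𝓞 K) K) =>
      ((siegelKernelSlice η θ g b Y : ℝ) : ℂ) := by
    simpa only [Function.comp_def, Homeomorph.coe_mulLeft, siegelKernelSlice_apply] using h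
  exact h'

omit [(AdelicGroupData.gl n K).IsAutomorphicMeasure μ] in
/-- **`R(η) f ([θ a⁻¹ (1+Y)]) = ∫ E_g(Y) f(g⁻¹ a⁻¹ x₀) dg`**: the smoothed form along the block
unipotents at the point `[θ a⁻¹]`, `a = posRealDiagonal b`, is the orbital integral of the kernel
slice (`θ a⁻¹ (1+Y) = (θ (1 + blockConj b Y)) a⁻¹`, `smul_basePoint`, `orbitalSmoothing_smul`).
[folklore] -/
theorem smoothedForm_translate_unipotent_eq_integral (η : GL (Fin n) (AdeleRing (𝓞 K) K) → ℝ)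
    (θ : GL (Fin n) (AdeleRing (𝓞 K) K)) (f : (AdelicGroupData.gl n K).L2 μ) (b : Fin n → ℝ≥0ˣ)
    {a x : (AdelicGroupData.gl n K).Adelic} (ha : a = posRealDiagonal n K b)
    (hx : x = θ * (posRealDiagonal n K b)⁻¹) (Y : blockNilpotent n k (AdeleRing (𝓞 K) K)) :
    smoothedForm η f
        ((AdelicGroupData.gl n K).toAutomorphicQuotient (x * glUnipotent n k K (Multiplicative.ofAdd Y))) =
      ∫ g, ((siegelKernelSlice η θ g b Y : ℝ) : ℂ) *
        (f : (AdelicGroupData.gl n K).automorphicQuotient → ℂ) (g⁻¹ • a⁻¹ • basePoint n K)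
          ∂(adelicHaar n K) := by
  -- the acting element `θ (1 + blockConj b Y)`, at the datum's type
  set w : (AdelicGroupData.gl n K).Adelic :=
    θ * unipotentOfBlock n k (AdeleRing (𝓞 K) K) (Multiplicative.ofAdd (blockConj b Y)) with hw
  have h1 : (AdelicGroupData.gl n K).toAutomorphicQuotient
      (x * glUnipotent n k K (Multiplicative.ofAdd Y)) = w • (a⁻¹ • basePoint n K) := by
    rw [← mul_smul, smul_basePoint]
    congr 1
    rw [hx, ha]
    exact mul_posRealDiagonal_inv_mul_unipotentOfBlock θ b Y
  unfold smoothedForm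
  rw [h1, orbitalSmoothing_smul]
  congr 1 with g

/-- The orbital integrand `g ↦ E_g(Y) f(g⁻¹ • y)` is integrable (a continuous compactly supported
weight against an `L²`, hence `L¹`, class along an open orbit; `integrable_smul_comp_inv_smul`).
[folklore] -/
theorem integrable_siegelKernelSlice_mul {η : GL (Fin n) (AdeleRing (𝓞 K) K) → ℝ}
    (hη : Continuous η) (hηs : HasCompactSupport η) (θ : GL (Fin n) (AdeleRing (𝓞 K) K))
    (f : (AdelicGroupData.gl n K).L2 μ) (b : Fin n → ℝ≥0ˣ)
    (y : (AdelicGroupData.gl n K).automorphicQuotient) (Y : blockNilpotent n k (AdeleRing (𝓞 K) K)) :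
    Integrable (fun g : (AdelicGroupData.gl n K).Adelic => ((siegelKernelSlice η θ g b Y : ℝ) : ℂ) *
      (f : (AdelicGroupData.gl n K).automorphicQuotient → ℂ) (g⁻¹ • y)) (adelicHaar n K) := by
  have h := integrable_smul_comp_inv_smul μ (adelicHaar n K) (isOpenMap_smul_automorphicQuotient n K y)
    (continuous_siegelKernelSlice_left hη θ b Y) (hasCompactSupport_siegelKernelSlice_left hηs θ b Y)
    (integrable_coeFn_L2 μ f)
  simpa only [smul_eq_mul] using h

set_option backward.isDefEq.respectTransparency false in
open scoped Matrix.Norms.Operator in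
/-- **Iterated differences of a smoothed `L²`-form along the block unipotents at a cusp point.**
Let `η` be a test function, `Θ ∋ θ` and `W` compact, `c ∈ 𝓞 K` with the level invariance `hcinv`
of `IsTestFunctionGL.exists_int_forall_unipotentOfBlock_mul_eq`, `a = posRealDiagonal b`,
`x = θ a⁻¹`, and `Xᵢ` steps in the scaled Tate domain `c · 𝓕₀` whose partial sums have their
conjugates `a⁻¹(1 + Σ X)a` in `W`. If the archimedean slices through the points of `Θ · C♯`,
`C♯ = W⁻¹ Θ⁻¹ supp η`, have `q`-th derivatives bounded by `B` (`q` the number of steps) and the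
archimedean steps have `‖siegelArchStep θ b Xᵢ‖ ≤ σ`, then for every `f ∈ L²`
`‖Δ_{X₁} ⋯ Δ_{X_q} h (0)‖ ≤ B σ^q ∫_{C♯} ‖f(g⁻¹ a⁻¹ x₀)‖ dg`,
where `h(Y) = R(η) f ([x (1+Y)])`: `h` is the orbital integral of the kernel slice
(`smoothedForm_translate_unipotent_eq_integral`), its differences are the orbital integrals of the
differences of the slice (`iterFwdDiff_integral`), and those vanish off `C♯`
(`iterFwdDiff_siegelKernelSlice_eq_zero`) and are at most `B σ^q` on it (finite steps drop out,
archimedean steps are smooth: `GLnCuspidalSiegelKernel`). The mass integral is written as the real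
part of a lower Lebesgue integral, the form bounded in `GLnCuspidalSiegelMass`. (Garrett (2018),
proof of Thm. 7.3.10, PDF pp. 339–342, in Poisson-free form.)
[cite: Garrett2018, Thm. 7.3.10 (proof, PDF pp. 339–342)] -/
theorem norm_iterFwdDiff_smoothedForm_unipotent_le {η : GL (Fin n) (AdeleRing (𝓞 K) K) → ℝ}
    (hη : IsTestFunctionGL n K η) {Θ W : Set (GL (Fin n) (AdeleRing (𝓞 K) K))}
    (hΘ : IsCompact Θ) (hWc : IsCompact W) {θ : GL (Fin n) (AdeleRing (𝓞 K) K)} (hθ : θ ∈ Θ)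
    {c : 𝓞 K}
    (hcinv : ∀ θ ∈ Θ, ∀ P : blockNilpotent n k (AdeleRing (𝓞 K) K),
      (∀ i j, ((P : Matrix (Fin n) (Fin n) (AdeleRing (𝓞 K) K)) i j).1 = 0) →
      (∀ i j, ∃ y ∈ integralFiniteAdeles K,
        ((P : Matrix (Fin n) (Fin n) (AdeleRing (𝓞 K) K)) i j).2 =
          algebraMap (𝓞 K) (FiniteAdeleRing (𝓞 K) K) c * y) →
      ∀ g, η (θ * unipotentOfBlock n k (AdeleRing (𝓞 K) K) (Multiplicative.ofAdd P) * g) = η (θ * g))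
    (b : Fin n → ℝ≥0ˣ) {l : List (blockNilpotent n k (AdeleRing (𝓞 K) K))}
    (hl : ∀ w ∈ l, w ∈ scaledBlockFundamentalDomain n k K (c : K))
    (hW : ∀ s : List (blockNilpotent n k (AdeleRing (𝓞 K) K)), s.Sublist l →
      (posRealDiagonal n K b)⁻¹ *
          unipotentOfBlock n k (AdeleRing (𝓞 K) K) (Multiplicative.ofAdd s.sum) *
        posRealDiagonal n K b ∈ W)
    {B : ℝ} (hB : ∀ x ∈ Θ * (W⁻¹ * Θ⁻¹ * tsupport η), ∀ m,
      ‖iteratedFDeriv ℝ l.length (leftArchSlice η x) m‖ ≤ B)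
    {σ : ℝ} (hσ : ∀ w ∈ l, ‖siegelArchStep θ b w‖ ≤ σ)
    (f : (AdelicGroupData.gl n K).L2 μ)
    {a x : (AdelicGroupData.gl n K).Adelic} (ha : a = posRealDiagonal n K b)
    (hx : x = θ * (posRealDiagonal n K b)⁻¹) :
    ‖iterFwdDiff l (fun Y => smoothedForm η f
        ((AdelicGroupData.gl n K).toAutomorphicQuotient
          (x * glUnipotent n k K (Multiplicative.ofAdd Y)))) 0‖ ≤
      B * σ ^ l.length *
        (∫⁻ g in W⁻¹ * Θ⁻¹ * tsupport η, ‖(f : (AdelicGroupData.gl n K).automorphicQuotient → ℂ)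
          (g⁻¹ • a⁻¹ • basePoint n K)‖ₑ ∂(adelicHaar n K)).toReal := by
  haveI : T2Space (AdelicGroupData.gl n K).Adelic := t2Space_gl n K
  haveI : T2Space (GL (Fin n) (AdeleRing (𝓞 K) K)) := t2Space_gl n K
  -- the region where the kernel lives, at the datum's type
  set Cs : Set (AdelicGroupData.gl n K).Adelic := W⁻¹ * Θ⁻¹ * tsupport η with hCs
  have hCsc' : IsCompact (W⁻¹ * Θ⁻¹ * tsupport η) := (hWc.inv.mul hΘ.inv).mul hη.hasCompactSupport
  have hCsc : IsCompact Cs := hCsc'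
  have hCsm : MeasurableSet Cs := hCsc.isClosed.measurableSet
  set y₀ : (AdelicGroupData.gl n K).automorphicQuotient := a⁻¹ • basePoint n K with hy₀
  set Φ : blockNilpotent n k (AdeleRing (𝓞 K) K) → (AdelicGroupData.gl n K).Adelic → ℂ :=
    fun Y g => ((siegelKernelSlice η θ g b Y : ℝ) : ℂ) *
      (f : (AdelicGroupData.gl n K).automorphicQuotient → ℂ) (g⁻¹ • y₀) with hΦ
  -- the smoothed form is the orbital integral of the kernel slice
  have hrepr : (fun Y => smoothedForm η f
      ((AdelicGroupData.gl n K).toAutomorphicQuotient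
        (x * glUnipotent n k K (Multiplicative.ofAdd Y)))) =
      fun Y => ∫ g, Φ Y g ∂(adelicHaar n K) :=
    funext fun Y => smoothedForm_translate_unipotent_eq_integral η θ f b ha hx Y
  have hΦi : ∀ Y, Integrable (Φ Y) (adelicHaar n K) := fun Y =>
    integrable_siegelKernelSlice_mul hη.continuous hη.hasCompactSupport θ f b y₀ Y
  rw [hrepr, (iterFwdDiff_integral Φ hΦi l).2 0]
  -- pointwise bound on the differences of the kernel slice
  have hpt : ∀ g : GL (Fin n) (AdeleRing (𝓞 K) K), ‖iterFwdDiff l (fun Y => Φ Y g) 0‖ ≤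
      Cs.indicator (fun g => B * σ ^ l.length *
        ‖(f : (AdelicGroupData.gl n K).automorphicQuotient → ℂ) (g⁻¹ • y₀)‖) g := by
    intro g
    simp only [hΦ]
    rw [iterFwdDiff_ofReal_mul_const]
    by_cases hg : g ∈ Cs
    · rw [indicator_of_mem hg, norm_mul, Complex.norm_real]
      refine mul_le_mul_of_nonneg_right ?_ (norm_nonneg _)
      have h1 := congrFun (iterFwdDiff_siegelKernelSlice_eq_map_blockArchPart (η := η) (g := g) (b := b)
        hcinv hθ hl) 0
      rw [h1, iterFwdDiff_map_blockArchPart_siegelKernelSlice]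
      have hg' : g ∈ W⁻¹ * Θ⁻¹ * tsupport η := hg
      have hB' : ∀ m, ‖iteratedFDeriv ℝ (l.map (siegelArchStep θ b)).length
          (leftArchSlice η (θ * g)) m‖ ≤ B := fun m => by
        rw [List.length_map]
        exact hB (θ * g) (Set.mul_mem_mul hθ hg') m
      have hσ' : ∀ Wm ∈ l.map (siegelArchStep θ b), ‖Wm‖ ≤ σ := fun Wm hWm => by
        obtain ⟨w, hw, rfl⟩ := List.mem_map.1 hWm
        exact hσ w hw
      have h2 := norm_iterFwdDiff_translate_leftArchSlice_le hη (θ * g) hB' hσ'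
      rwa [List.length_map] at h2
    · have hg' : g ∉ W⁻¹ * Θ⁻¹ * tsupport η := hg
      rw [indicator_of_notMem hg, iterFwdDiff_siegelKernelSlice_eq_zero hθ hW hg', Complex.ofReal_zero,
        zero_mul, norm_zero]
  -- integrate
  obtain ⟨C, hC, hdom⟩ := exists_measure_inter_invOrbitPreimage_le μ (adelicHaar n K)
    (isOpenMap_smul_automorphicQuotient n K y₀) hCsc
  have hfi : IntegrableOn (fun g : (AdelicGroupData.gl n K).Adelic =>
      (f : (AdelicGroupData.gl n K).automorphicQuotient → ℂ) (g⁻¹ • y₀)) Cs (adelicHaar n K) :=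
    Integrable.comp_inv_smul μ (adelicHaar n K) hC hdom (integrable_coeFn_L2 μ f)
  have hint : Integrable (Cs.indicator fun g => B * σ ^ l.length *
      ‖(f : (AdelicGroupData.gl n K).automorphicQuotient → ℂ) (g⁻¹ • y₀)‖) (adelicHaar n K) :=
    IntegrableOn.integrable_indicator (hfi.norm.const_mul (B * σ ^ l.length)) hCsm
  calc ‖∫ g, iterFwdDiff l (fun Y => Φ Y g) 0 ∂(adelicHaar n K)‖
      ≤ ∫ g, Cs.indicator (fun g => B * σ ^ l.length *
          ‖(f : (AdelicGroupData.gl n K).automorphicQuotient → ℂ) (g⁻¹ • y₀)‖) g ∂(adelicHaar n K) :=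
        norm_integral_le_of_norm_le hint (Eventually.of_forall hpt)
    _ = B * σ ^ l.length * ∫ g in Cs, ‖(f : (AdelicGroupData.gl n K).automorphicQuotient → ℂ)
          (g⁻¹ • y₀)‖ ∂(adelicHaar n K) := by
        rw [integral_indicator hCsm, integral_const_mul]
    _ = B * σ ^ l.length * (∫⁻ g in Cs, ‖(f : (AdelicGroupData.gl n K).automorphicQuotient → ℂ)
          (g⁻¹ • y₀)‖ₑ ∂(adelicHaar n K)).toReal := by
        rw [integral_norm_eq_lintegral_enorm hfi.aestronglyMeasurable]

end Orbital

end Literature.NumberTheory.Automorphic
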